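import Mathlib.Analysis.SpecialFunctions.Pow.NthRootLemmas
import Mathlib.Analysis.SpecificLimits.Normed
import Literature.Computability.MetaComplexity.SmolenskyMajority
import HarnessLib

/-!
# The Razborov–Smolensky natural property against `AC⁰[p]` at every length

Continuation of `SmolenskyMajority.lean` (groundwork for the named fact
`Literature.Computability.Learning.cikk_learn_AC0Mod`, CIKK 2016 Cor. 5.4, via CIKK Thm. 5.3:
"for every prime `p` there is a natural property with largeness `≥ 1/2` useful against depth-`d`
`AC⁰[p]` circuits of size `2^{Ω(n^{1/(2d)})}`"). The `0/1` dimension property `iproperty (ZMod p)`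
of that file is stated for an odd number of variables ("without loss of generality, assume `n` is
odd", CIKK §5.2); this file packages it as ONE combinatorial property `rsProperty p` defined at
every length — at even lengths `m + 1` a function is accepted iff its restriction `x₀ := 0` is —
and proves, for every prime `p` (including `2`):

* `card_le_two_mul_card_of_pairing` — the counting behind all largeness statements here: an
  involution `φ` with `x ∈ G ∨ φ x ∈ G` for all `x` forces `|G| ≥ |α|/2`;
  `exists_pairing_iproperty` — such a pairing for the odd-length property over any field
  (`h ↦ h ⊕ MAJ` in characteristic `2`, `h ↦ h ⊕ PARITY` otherwise), and its lift to the next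
  (even) length through the restriction (`liftFlip`, `restrictFirst_liftFlip`);
* **largeness `≥ 1/2` at every length**: `two_pow_le_two_mul_card_rsProperty`
  (`2^(2^n) ≤ 2 · |rsProperty p n|` for all `n`; this is `HasDensity 2` of
  `Learning/NaturalLearning.lean`, stated here without that import);
* restriction of low-degree polynomials (`funLeft_cons0_mem_lowDeg`) and the **usefulness of
  `rsProperty p` in exact form** at odd and even lengths, both for functions with a low-degree
  approximation off a small set (`not_mem_rsProperty_odd`, `not_mem_rsProperty_even` — the form a
  learner's analysis consumes) and for functions computed by small constant-depth circuits over
  `{¬, ∧, ∨, MOD_p}` (`not_mem_rsProperty_of_computes`, via the Razborov–Smolensky approximation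
  of `RazborovSmolenskyApprox.lean`; no circuit-restriction lemma is needed: approximate first,
  then restrict the polynomial);
* **usefulness against `AC⁰[p]` in the sense of `NaturalProofs.lean`**
  (`isUsefulAgainst_AC0Mod_rsProperty : IsUsefulAgainst (AC0Mod p) (rsProperty p)`): a language
  whose slices have the property infinitely often is not in `AC⁰[p]` — with the explicit
  parameter `ℓ(n) = ⌊((n-1)/64)^{1/(2d)}⌋ / (p-1)` (`lvl`, `lvl_spec`, `le_of_lvl`, `tendsto_lvl`)
  and the growth lemma `eventually_mul_pow_lt_two_pow`; together with the largeness above this is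
  Razborov–Rudich's "the `AC⁰[p]` lower bounds are natural" up to constructivity.

Constructivity (`truthTableLanguage (rsProperty p) ∈ P`: Gaussian elimination over `𝔽_p` on the
`2ⁿ` spanning vectors of `gL + L`) is NOT in this file.

## References

* A. A. Razborov, S. Rudich, *Natural proofs*, JCSS 55 (1997), §3.2 (the `AC⁰[p]` lower bounds
  are natural) [RazborovRudich1997].
* M. Carmosino, R. Impagliazzo, V. Kabanets, A. Kolokolova, *Learning algorithms from natural
  proofs*, CCC 2016, LIPIcs 50, Thm. 5.3, §5.2 [CarmosinoImpagliazzoKabanetsKolokolova2016].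
* R. Smolensky, *Algebraic methods in the theory of lower bounds for Boolean circuit complexity*,
  STOC 1987, 77–82 [Smolensky1987].

## Design notes

* Even lengths are reduced to odd ones by fixing the FIRST coordinate to `0` (`Fin.cons`), which
  keeps the bookkeeping to `Fin.cons`/`Fin.tail`; length `0` accepts everything.
* No named facts are introduced (D-0026): every statement below is proved.
-/

namespace Literature.Computability.MetaComplexity

open Finset Module Literature.Computability.Complexity

namespace Smolensky

variable {F : Type*} [Field F] {n : ℕ}

/-! ### Pairings and the counting lemma -/

/-- **The pairing count**: if an involution `φ` of a finite type satisfies `x ∈ G ∨ φ x ∈ G` for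
every `x`, then `|α| ≤ 2|G|`. [folklore] -/
theorem card_le_two_mul_card_of_pairing {α : Type*} [Fintype α] (G : Set α) (φ : α → α)
    (hφ : Function.Involutive φ) (hcov : ∀ x, x ∈ G ∨ φ x ∈ G) :
    Fintype.card α ≤ 2 * Nat.card G := by
  classical
  set good : Finset α := univ.filter fun x => x ∈ G with hgood
  have hcard : Nat.card G = good.card := by
    rw [Nat.card_eq_fintype_card, ← Set.toFinset_card]
    congr 1
    ext x
    simp [hgood]
  have hcover : (univ : Finset α) ⊆ good ∪ good.image φ := by
    intro x _
    rcases hcov x with hx | hx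
    · exact Finset.mem_union_left _ (by simp [hgood, hx])
    · refine Finset.mem_union_right _ (Finset.mem_image.2 ⟨φ x, by simp [hgood, hx], hφ x⟩)
  calc Fintype.card α = (univ : Finset α).card := Finset.card_univ.symm
    _ ≤ (good ∪ good.image φ).card := Finset.card_le_card hcover
    _ ≤ good.card + (good.image φ).card := Finset.card_union_le _ _
    _ ≤ good.card + good.card := Nat.add_le_add_left Finset.card_image_le _
    _ = 2 * Nat.card G := by rw [hcard]; ring

/-- **A pairing for the odd-length property over any field**: for odd `n` there is an involution
`φ` of the Boolean functions with `h ∈ iproperty F n ∨ φ h ∈ iproperty F n` for all `h`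
(`h ↦ h ⊕ MAJ` if `2 = 0` in `F`, `h ↦ h ⊕ PARITY` otherwise). [folklore] -/
theorem exists_pairing_iproperty (hn : Odd n) :
    ∃ φ : ((Fin n → Bool) → Bool) → ((Fin n → Bool) → Bool),
      Function.Involutive φ ∧ ∀ h, h ∈ iproperty F n ∨ φ h ∈ iproperty F n := by
  by_cases h2 : (2 : F) = 0
  · refine ⟨majFlip, majFlip_majFlip, fun h => ?_⟩
    rw [mem_iproperty_iff, mem_iproperty_iff]
    have := three_mul_two_pow_le_of_two_eq_zero (F := F) hn h2 h
    omega
  · refine ⟨parityFlip, parityFlip_parityFlip, fun h => ?_⟩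
    rw [mem_iproperty_iff, mem_iproperty_iff, ispace_eq_space h2, ispace_eq_space h2]
    have := three_mul_two_pow_le (F := F) hn h2 h
    omega

/-! ### Restriction to `x₀ = 0` and the lift of a pairing -/

/-- Prepend the bit `0`: `b ↦ (0, b)`. [folklore] -/
def cons0 (b : Fin n → Bool) : Fin (n + 1) → Bool := Fin.cons false b

/-- `cons0 b 0 = 0`. [folklore] -/
@[simp] theorem cons0_zero (b : Fin n → Bool) : cons0 b 0 = false := rfl

/-- `cons0 b (j+1) = b j`. [folklore] -/
@[simp] theorem cons0_succ (b : Fin n → Bool) (j : Fin n) : cons0 b j.succ = b j := by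
  simp [cons0]

/-- `tail (cons0 b) = b`. [folklore] -/
@[simp] theorem tail_cons0 (b : Fin n → Bool) : Fin.tail (cons0 b) = b := by
  simp [cons0]

/-- A point with first bit `0` is `cons0` of its tail. [folklore] -/
theorem cons0_tail {c : Fin (n + 1) → Bool} (hc : c 0 = false) : cons0 (Fin.tail c) = c := by
  rw [cons0, ← hc, Fin.cons_self_tail]

/-- `cons0` is injective. [folklore] -/
theorem cons0_injective : Function.Injective (cons0 (n := n)) := by
  intro b b' h
  have := congrArg Fin.tail h
  simpa using this

/-- The restriction `x₀ := 0` of a Boolean function of `n + 1` variables. [folklore] -/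
def restrictFirst (h : (Fin (n + 1) → Bool) → Bool) : (Fin n → Bool) → Bool := fun b => h (cons0 b)

/-- The lift of a map `φ` on `n`-variable functions to `(n+1)`-variable functions: keep `h` on
`x₀ = 1`, apply `φ` to the restriction on `x₀ = 0`. [folklore] -/
def liftFlip (φ : ((Fin n → Bool) → Bool) → ((Fin n → Bool) → Bool))
    (h : (Fin (n + 1) → Bool) → Bool) : (Fin (n + 1) → Bool) → Bool :=
  fun c => if c 0 then h c else φ (restrictFirst h) (Fin.tail c)

/-- The lift acts as `φ` on the restriction. [folklore] -/
theorem restrictFirst_liftFlip (φ : ((Fin n → Bool) → Bool) → ((Fin n → Bool) → Bool))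
    (h : (Fin (n + 1) → Bool) → Bool) : restrictFirst (liftFlip φ h) = φ (restrictFirst h) := by
  funext b
  simp [restrictFirst, liftFlip]

/-- The lift of an involution is an involution. [folklore] -/
theorem liftFlip_liftFlip {φ : ((Fin n → Bool) → Bool) → ((Fin n → Bool) → Bool)}
    (hφ : Function.Involutive φ) (h : (Fin (n + 1) → Bool) → Bool) :
    liftFlip φ (liftFlip φ h) = h := by
  funext c
  by_cases hc : c 0 = true
  · simp [liftFlip, hc]
  · have hc' : c 0 = false := by simpa using hc
    have h1 : liftFlip φ (liftFlip φ h) c = φ (restrictFirst (liftFlip φ h)) (Fin.tail c) := by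
      simp [liftFlip, hc']
    rw [h1, restrictFirst_liftFlip, hφ (restrictFirst h)]
    simp only [restrictFirst]
    rw [cons0_tail hc']

/-! ### The property at every length -/

/-- **The Razborov–Smolensky natural property for the prime `p`, at every length**: at odd
lengths `n`, "`dim_{𝔽_p}(gL + L) ≥ (3/4)2ⁿ`" (`iproperty (ZMod p)`, the printed property of CIKK
Thm. 5.3 for `p > 2`, its `0/1` version for `p = 2`); at even lengths `m + 1`, the same for the
restriction `x₀ := 0` ("without loss of generality, assume `n` is odd"); everything at length `0`.
[cite: CarmosinoImpagliazzoKabanetsKolokolova2016, Thm. 5.3 (§5.2)] -/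
def rsProperty (p : ℕ) [Fact p.Prime] : CombinatorialProperty
  | 0 => Set.univ
  | m + 1 => if Odd (m + 1) then iproperty (ZMod p) (m + 1)
      else {h | restrictFirst h ∈ iproperty (ZMod p) m}

variable {p : ℕ} [Fact p.Prime]

/-- Unfolding at odd lengths. [folklore] -/
theorem rsProperty_of_odd (p : ℕ) [Fact p.Prime] (hn : Odd n) :
    rsProperty p n = iproperty (ZMod p) n := by
  obtain ⟨m, rfl⟩ : ∃ m, n = m + 1 := ⟨n - 1, by obtain ⟨k, rfl⟩ := hn; omega⟩
  simp [rsProperty, hn]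

/-- Unfolding at even positive lengths. [folklore] -/
theorem rsProperty_succ_of_odd (p : ℕ) [Fact p.Prime] {m : ℕ} (hm : Odd m) :
    rsProperty p (m + 1) = {h | restrictFirst h ∈ iproperty (ZMod p) m} := by
  have hne : ¬Odd (m + 1) := by
    rw [Nat.odd_add_one, not_not]
    exact hm
  simp [rsProperty, hne]

/-- **Largeness `≥ 1/2` at every length** (CIKK Thm. 5.3, "largeness at least `1/2`"):
`2^(2^n) ≤ 2 · |rsProperty p n|` for every `n` (the form `HasDensity 2`). Odd `n`: the pairing of
`exists_pairing_iproperty`; even `m + 1`: its lift through the restriction; `n = 0`: everything.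
[cite: CarmosinoImpagliazzoKabanetsKolokolova2016, Thm. 5.3] -/
theorem two_pow_le_two_mul_card_rsProperty (p : ℕ) [Fact p.Prime] (n : ℕ) :
    2 ^ (2 ^ n) ≤ 2 * Nat.card (rsProperty p n) := by
  have hcardfun : ∀ k, Fintype.card ((Fin k → Bool) → Bool) = 2 ^ (2 ^ k) := fun k => by simp
  rcases n with _ | m
  · -- length `0`: everything is accepted
    have : Nat.card (rsProperty p 0) = Nat.card ((Fin 0 → Bool) → Bool) := by
      rw [show rsProperty p 0 = Set.univ from rfl]
      exact Nat.card_congr (Equiv.Set.univ _)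
    rw [this, Nat.card_eq_fintype_card, hcardfun]
    omega
  · rcases Nat.even_or_odd m with hm | hm
    · -- `m + 1` odd
      have hodd : Odd (m + 1) := hm.add_one
      obtain ⟨φ, hφ, hcov⟩ := exists_pairing_iproperty (F := ZMod p) hodd
      rw [rsProperty_of_odd p hodd, ← hcardfun]
      exact card_le_two_mul_card_of_pairing _ φ hφ hcov
    · -- `m + 1` even, `m` odd: lift the pairing of length `m`
      obtain ⟨φ, hφ, hcov⟩ := exists_pairing_iproperty (F := ZMod p) hm
      rw [rsProperty_succ_of_odd p hm, ← hcardfun]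
      refine card_le_two_mul_card_of_pairing _ (liftFlip φ) (liftFlip_liftFlip hφ) fun h => ?_
      simp only [Set.mem_setOf_eq, restrictFirst_liftFlip]
      exact hcov (restrictFirst h)

/-! ### Restricting low-degree polynomials -/

omit [Fact p.Prime] in
/-- Restricting a monomial to `x₀ = 0`: zero if it contains `x₀`, otherwise the monomial of the
shifted set. [folklore] -/
theorem funLeft_cons0_mono (S : Finset (Fin (n + 1))) :
    LinearMap.funLeft F F cons0 (mono F S) =
      if (0 : Fin (n + 1)) ∈ S then 0 else mono F (univ.filter fun j : Fin n => j.succ ∈ S) := by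
  funext b
  rw [LinearMap.funLeft_apply]
  by_cases h0 : (0 : Fin (n + 1)) ∈ S
  · rw [if_pos h0, Pi.zero_apply, mono_apply, if_neg]
    intro hall
    exact absurd (hall 0 h0) (by simp)
  · rw [if_neg h0, mono_apply, mono_apply]
    by_cases hall : ∀ i ∈ S, cons0 b i = true
    · rw [if_pos hall, if_pos]
      intro j hj
      have := hall j.succ (by simpa using hj)
      simpa using this
    · rw [if_neg hall, if_neg]
      intro hall'
      refine hall fun i hi => ?_
      rcases Fin.eq_zero_or_eq_succ i with rfl | ⟨j, rfl⟩
      · exact absurd hi h0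
      · rw [cons0_succ]
        exact hall' j (by simpa using hi)

omit [Fact p.Prime] in
/-- **`lowDeg` is stable under the restriction `x₀ := 0`**: if `u` has degree `≤ D` in `n + 1`
variables then `b ↦ u(0, b)` has degree `≤ D` in `n` variables. [folklore] -/
theorem funLeft_cons0_mem_lowDeg {D : ℕ} {u : CubeFn F (n + 1)} (hu : u ∈ lowDeg F (n + 1) D) :
    LinearMap.funLeft F F cons0 u ∈ lowDeg F n D := by
  classical
  have hle : (lowDeg F (n + 1) D).map (LinearMap.funLeft F F (cons0 (n := n))) ≤ lowDeg F n D := by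
    rw [lowDeg_eq_span (D := D), Submodule.map_span_le]
    rintro _ ⟨⟨S, hS⟩, rfl⟩
    dsimp only
    rw [funLeft_cons0_mono]
    split_ifs with h0
    · exact Submodule.zero_mem _
    · refine mono_mem_lowDeg (le_trans ?_ hS)
      refine Finset.card_le_card_of_injOn Fin.succ (fun j hj => by simpa using hj) ?_
      exact (Fin.succ_injective n).injOn
  exact hle (Submodule.mem_map_of_mem hu)

/-! ### Usefulness in exact form -/

/-- **Usefulness at odd lengths, approximation form**: for odd `n`, if `[h]` agrees outside `E`
with a polynomial function over `𝔽_p` of degree `≤ D` and `4 · (D · C(n, n/2) + |E|) < 2ⁿ`, then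
`h ∉ rsProperty p n`. [cite: CarmosinoImpagliazzoKabanetsKolokolova2016, Thm. 5.3] -/
theorem not_mem_rsProperty_odd (hn : Odd n) (h : (Fin n → Bool) → Bool) {D : ℕ}
    {P : CubeFn (ZMod p) n} (hP : P ∈ lowDeg (ZMod p) n D) (E : Finset (Fin n → Bool))
    (hE : ∀ b, b ∉ E → indOf (ZMod p) h b = P b)
    (hlt : 4 * (D * n.choose (n / 2) + E.card) < 2 ^ n) : h ∉ rsProperty p n := by
  rw [rsProperty_of_odd p hn]
  exact not_mem_iproperty hn h hP E hE hlt

/-- **Usefulness at even lengths, approximation form**: for odd `m`, if `[h]` (`h` of `m + 1`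
variables) agrees outside `E` with a polynomial function over `𝔽_p` of degree `≤ D` and
`4 · (D · C(m, m/2) + |E|) < 2ᵐ`, then `h ∉ rsProperty p (m + 1)` (restrict the approximation to
`x₀ = 0`). [cite: CarmosinoImpagliazzoKabanetsKolokolova2016, Thm. 5.3] -/
theorem not_mem_rsProperty_even {m : ℕ} (hm : Odd m) (h : (Fin (m + 1) → Bool) → Bool) {D : ℕ}
    {P : CubeFn (ZMod p) (m + 1)} (hP : P ∈ lowDeg (ZMod p) (m + 1) D)
    (E : Finset (Fin (m + 1) → Bool)) (hE : ∀ c, c ∉ E → indOf (ZMod p) h c = P c)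
    (hlt : 4 * (D * m.choose (m / 2) + E.card) < 2 ^ m) : h ∉ rsProperty p (m + 1) := by
  classical
  rw [rsProperty_succ_of_odd p hm, Set.mem_setOf_eq]
  set E' : Finset (Fin m → Bool) := univ.filter fun b => cons0 b ∈ E with hE'
  have hcard : E'.card ≤ E.card :=
    Finset.card_le_card_of_injOn cons0 (fun b hb => (Finset.mem_filter.1 hb).2)
      (cons0_injective.injOn)
  refine not_mem_iproperty hm (restrictFirst h) (funLeft_cons0_mem_lowDeg hP) E' ?_ ?_
  · intro b hb
    have hbE : cons0 b ∉ E := fun h' => hb (by simp [hE', h'])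
    rw [LinearMap.funLeft_apply, ← hE _ hbE]
    rfl
  · calc 4 * (D * m.choose (m / 2) + E'.card) ≤ 4 * (D * m.choose (m / 2) + E.card) := by
          gcongr
      _ < 2 ^ m := hlt

/-- The odd length `n↓` at which the property of length `n ≥ 1` is evaluated: `n` itself if `n` is
odd, `n - 1` otherwise. [folklore] -/
def oddFloor (n : ℕ) : ℕ := if Odd n then n else n - 1

omit [Fact p.Prime] in
/-- For `n ≥ 1`, `oddFloor n` is odd. [folklore] -/
theorem odd_oddFloor (hn : 1 ≤ n) : Odd (oddFloor n) := by
  unfold oddFloor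
  split_ifs with h
  · exact h
  · rcases Nat.even_or_odd n with he | ho
    · obtain ⟨k, rfl⟩ := he
      exact ⟨k - 1, by omega⟩
    · exact absurd ho h

omit [Fact p.Prime] in
/-- `oddFloor n ≤ n`. [folklore] -/
theorem oddFloor_le (n : ℕ) : oddFloor n ≤ n := by
  unfold oddFloor; split_ifs <;> omega

/-- **Usefulness of `rsProperty p` against `AC⁰[p]` circuits, exact form, every length `n ≥ 1`**
(CIKK Thm. 5.3; Smolensky 1987): for a circuit `C` over `accBasis p` of `acDepth ≤ d` computing
`h : {0,1}ⁿ → {0,1}`, and `ℓ ≥ 1` with, writing `m = oddFloor n`,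
`4 · ((p-1)ℓ)^d · C(m, m/2) · p^ℓ + 4 · size(C) · 2ⁿ < 2ᵐ · p^ℓ`, one has `h ∉ rsProperty p n`.
(Approximate `C` by a polynomial of degree `((p-1)ℓ)^d` off `E`, `|E| p^ℓ ≤ size · 2ⁿ`; at even
`n` restrict to `x₀ = 0`; apply the dimension bound at the odd length `m`.)
[cite: CarmosinoImpagliazzoKabanetsKolokolova2016, Thm. 5.3] -/
theorem not_mem_rsProperty_of_computes (hn : 1 ≤ n) {d : ℕ} (C : Circuit (Fin n))
    (hC : C.IsOver (accBasis p)) (hd : C.acDepth ≤ d) {h : (Fin n → Bool) → Bool}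
    (hh : C.Computes h) {ℓ : ℕ} (hℓ : 1 ≤ ℓ)
    (hlt : 4 * ((p - 1) * ℓ) ^ d * (oddFloor n).choose (oddFloor n / 2) * p ^ ℓ +
      4 * C.size * 2 ^ n < 2 ^ oddFloor n * p ^ ℓ) :
    h ∉ rsProperty p n := by
  have hp := (Fact.out : p.Prime)
  have hM1 : 1 ≤ (p - 1) * ℓ := Nat.mul_pos (by have := hp.two_le; omega) hℓ
  obtain ⟨P, E, hP, hE, hPE⟩ := razborov_smolensky C hC hℓ
  have hP' : P ∈ lowDeg (ZMod p) n (((p - 1) * ℓ) ^ d) :=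
    lowDeg_mono (Nat.pow_le_pow_right hM1 hd) hP
  have hagree : ∀ b, b ∉ E → indOf (ZMod p) h b = P b := by
    intro b hb
    rw [hPE b hb, hh b]
    simp only [indOf_apply, bit]
  -- the counting inequality at the odd length `m = oddFloor n`
  have hineq : 4 * (((p - 1) * ℓ) ^ d * (oddFloor n).choose (oddFloor n / 2) + E.card) <
      2 ^ oddFloor n := by
    have hppos : 0 < p ^ ℓ := pow_pos hp.pos ℓ
    refine Nat.lt_of_mul_lt_mul_right (a := p ^ ℓ) ?_
    calc 4 * (((p - 1) * ℓ) ^ d * (oddFloor n).choose (oddFloor n / 2) + E.card) * p ^ ℓ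
        = 4 * ((p - 1) * ℓ) ^ d * (oddFloor n).choose (oddFloor n / 2) * p ^ ℓ +
            4 * (E.card * p ^ ℓ) := by ring
      _ ≤ 4 * ((p - 1) * ℓ) ^ d * (oddFloor n).choose (oddFloor n / 2) * p ^ ℓ +
            4 * (C.size * 2 ^ n) := Nat.add_le_add_left (Nat.mul_le_mul_left 4 hE) _
      _ = 4 * ((p - 1) * ℓ) ^ d * (oddFloor n).choose (oddFloor n / 2) * p ^ ℓ +
            4 * C.size * 2 ^ n := by ring
      _ < 2 ^ oddFloor n * p ^ ℓ := hlt
  by_cases hodd : Odd n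
  · have hof : oddFloor n = n := by simp [oddFloor, hodd]
    rw [hof] at hineq
    exact not_mem_rsProperty_odd hodd h hP' E hagree hineq
  · -- `n = m + 1` with `m = oddFloor n` odd
    obtain ⟨m, rfl⟩ : ∃ m, n = m + 1 := ⟨n - 1, by omega⟩
    have hof : oddFloor (m + 1) = m := by simp [oddFloor, hodd]
    have hm : Odd m := by
      rcases Nat.even_or_odd m with he | ho
      · exact absurd he.add_one hodd
      · exact ho
    rw [hof] at hineq
    exact not_mem_rsProperty_even hm h hP' E hagree hineq

/-! ### Usefulness against `AC⁰[p]`: explicit parameters and the asymptotic form -/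

/-- **Usefulness with the standard parameter constraints**: for `n ≥ 1`, a circuit over
`accBasis p` of `acDepth ≤ d` computing `h`, and `ℓ ≥ 1` with `64((p-1)ℓ)^{2d} ≤ oddFloor n` and
`16 · size < p^ℓ`, the function `h` is rejected by `rsProperty p n` (the two constraints imply
the counting inequality of `not_mem_rsProperty_of_computes`, using `C(m, m/2)² m ≤ 4ᵐ`).
[cite: CarmosinoImpagliazzoKabanetsKolokolova2016, Thm. 5.3] -/
theorem not_mem_rsProperty_of_computes' (hn : 1 ≤ n) {d : ℕ} (C : Circuit (Fin n))
    (hC : C.IsOver (accBasis p)) (hd : C.acDepth ≤ d) {h : (Fin n → Bool) → Bool}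
    (hh : C.Computes h) {ℓ : ℕ} (hℓ : 1 ≤ ℓ)
    (hℓn : 64 * ((p - 1) * ℓ) ^ (2 * d) ≤ oddFloor n) (hsize : 16 * C.size < p ^ ℓ) :
    h ∉ rsProperty p n := by
  refine not_mem_rsProperty_of_computes hn C hC hd hh hℓ ?_
  have hmodd : Odd (oddFloor n) := odd_oddFloor hn
  generalize hm : oddFloor n = m at hℓn hmodd ⊢
  have hnm : n ≤ m + 1 := by rw [← hm]; unfold oddFloor; split_ifs <;> omega
  have hDC : 8 * (((p - 1) * ℓ) ^ d * m.choose (m / 2)) ≤ 2 ^ m := by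
    have hsq : (8 * (((p - 1) * ℓ) ^ d * m.choose (m / 2))) ^ 2 ≤ (2 ^ m) ^ 2 := by
      calc (8 * (((p - 1) * ℓ) ^ d * m.choose (m / 2))) ^ 2
          = 64 * ((p - 1) * ℓ) ^ (2 * d) * m.choose (m / 2) ^ 2 := by ring
        _ ≤ m * m.choose (m / 2) ^ 2 := Nat.mul_le_mul_right _ hℓn
        _ = m.choose (m / 2) ^ 2 * m := by ring
        _ ≤ 4 ^ m := choose_half_sq_mul_le hmodd
        _ = (2 ^ m) ^ 2 := by rw [← pow_mul, mul_comm, pow_mul]; norm_num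
    exact (Nat.pow_le_pow_iff_left two_ne_zero).1 hsq
  have h2n : 2 ^ n ≤ 2 * 2 ^ m :=
    calc 2 ^ n ≤ 2 ^ (m + 1) := Nat.pow_le_pow_right two_pos hnm
      _ = 2 * 2 ^ m := by rw [pow_succ, mul_comm]
  have hA : 2 * (4 * ((p - 1) * ℓ) ^ d * m.choose (m / 2) * p ^ ℓ) ≤ 2 ^ m * p ^ ℓ :=
    calc 2 * (4 * ((p - 1) * ℓ) ^ d * m.choose (m / 2) * p ^ ℓ)
        = 8 * (((p - 1) * ℓ) ^ d * m.choose (m / 2)) * p ^ ℓ := by ring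
      _ ≤ 2 ^ m * p ^ ℓ := Nat.mul_le_mul_right _ hDC
  have hB : 2 * (4 * C.size * 2 ^ n) < 2 ^ m * p ^ ℓ :=
    calc 2 * (4 * C.size * 2 ^ n) ≤ 2 * (4 * C.size * (2 * 2 ^ m)) := by gcongr
      _ = 16 * C.size * 2 ^ m := by ring
      _ < p ^ ℓ * 2 ^ m := Nat.mul_lt_mul_of_pos_right hsize (Nat.two_pow_pos m)
      _ = 2 ^ m * p ^ ℓ := mul_comm _ _
  have hsum := Nat.add_lt_add_of_le_of_lt hA hB
  linarith

/-- **Polynomial versus exponential growth**: `A (ℓ+1)^K < 2^ℓ` for all large `ℓ`. [folklore] -/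
theorem eventually_mul_pow_lt_two_pow (A K : ℕ) :
    ∀ᶠ ℓ : ℕ in Filter.atTop, A * (ℓ + 1) ^ K < 2 ^ ℓ := by
  have ht := tendsto_pow_const_div_const_pow_of_one_lt K (one_lt_two (α := ℝ))
  have hM : (0 : ℝ) < (A : ℝ) * 2 ^ K + 1 := by positivity
  have hev : ∀ᶠ ℓ : ℕ in Filter.atTop, (ℓ : ℝ) ^ K / 2 ^ ℓ < 1 / ((A : ℝ) * 2 ^ K + 1) :=
    ht.eventually (gt_mem_nhds (by positivity))
  filter_upwards [hev, Filter.eventually_ge_atTop 1] with ℓ hℓ hℓ1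
  have h2pos : (0 : ℝ) < 2 ^ ℓ := by positivity
  rw [div_lt_iff₀ h2pos, one_div, inv_mul_eq_div, lt_div_iff₀ hM] at hℓ
  have hnat : ℓ ^ K * (A * 2 ^ K + 1) < 2 ^ ℓ := by exact_mod_cast hℓ
  calc A * (ℓ + 1) ^ K ≤ A * (2 * ℓ) ^ K := Nat.mul_le_mul_left _ (Nat.pow_le_pow_left (by omega) K)
    _ = ℓ ^ K * (A * 2 ^ K) := by ring
    _ ≤ ℓ ^ K * (A * 2 ^ K + 1) := Nat.mul_le_mul_left _ (Nat.le_succ _)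
    _ < 2 ^ ℓ := hnat

/-- The approximation parameter `ℓ(n) = ⌊((n-1)/64)^{1/(2d)}⌋ / (p-1)` of the usefulness argument
(so that `64((p-1)ℓ)^{2d} ≤ n - 1`). [cite: CarmosinoImpagliazzoKabanetsKolokolova2016, Thm. 5.3 ("size up to 2^{Ω(n^{1/(2d)})}")] -/
def lvl (p d n : ℕ) : ℕ := Nat.nthRoot (2 * d) ((n - 1) / 64) / (p - 1)

omit [Fact p.Prime] in
/-- The parameter satisfies the degree constraint: `64((p-1)ℓ(n))^{2d} ≤ n - 1`. [folklore] -/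
theorem lvl_spec {d : ℕ} (hd : 1 ≤ d) (p n : ℕ) : 64 * ((p - 1) * lvl p d n) ^ (2 * d) ≤ n - 1 := by
  have h2d : 2 * d ≠ 0 := by omega
  have hr : Nat.nthRoot (2 * d) ((n - 1) / 64) ^ (2 * d) ≤ (n - 1) / 64 :=
    Nat.pow_nthRoot_le (Or.inl h2d)
  have hmul : (p - 1) * lvl p d n ≤ Nat.nthRoot (2 * d) ((n - 1) / 64) := Nat.mul_div_le _ _
  calc 64 * ((p - 1) * lvl p d n) ^ (2 * d) ≤ 64 * Nat.nthRoot (2 * d) ((n - 1) / 64) ^ (2 * d) := by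
        gcongr
    _ ≤ 64 * ((n - 1) / 64) := Nat.mul_le_mul_left _ hr
    _ ≤ n - 1 := Nat.mul_div_le (n - 1) 64

omit [Fact p.Prime] in
/-- Conversely `n` is polynomially bounded in the parameter: `n ≤ 64((p-1)(ℓ(n)+1))^{2d} + 64`
(for `p ≥ 2`). [folklore] -/
theorem le_of_lvl {d : ℕ} (hp : 2 ≤ p) (hd : 1 ≤ d) (n : ℕ) :
    n ≤ 64 * ((p - 1) * (lvl p d n + 1)) ^ (2 * d) + 64 := by
  have h2d : 2 * d ≠ 0 := by omega
  have hp1 : 0 < p - 1 := by omega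
  have hlt : (n - 1) / 64 < (Nat.nthRoot (2 * d) ((n - 1) / 64) + 1) ^ (2 * d) :=
    Nat.lt_pow_nthRoot_add_one h2d _
  have hr1 : Nat.nthRoot (2 * d) ((n - 1) / 64) + 1 ≤ (p - 1) * (lvl p d n + 1) := by
    have := Nat.lt_mul_div_succ (Nat.nthRoot (2 * d) ((n - 1) / 64)) hp1
    unfold lvl
    omega
  have h64 : n - 1 < 64 * ((n - 1) / 64 + 1) := Nat.lt_mul_div_succ (n - 1) (by norm_num)
  calc n ≤ 64 * ((n - 1) / 64 + 1) := by omega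
    _ ≤ 64 * ((Nat.nthRoot (2 * d) ((n - 1) / 64) + 1) ^ (2 * d) + 1) :=
        Nat.mul_le_mul_left _ (Nat.add_le_add_right hlt.le _)
    _ ≤ 64 * (((p - 1) * (lvl p d n + 1)) ^ (2 * d) + 1) := by gcongr
    _ = 64 * ((p - 1) * (lvl p d n + 1)) ^ (2 * d) + 64 := by ring

omit [Fact p.Prime] in
/-- The parameter tends to infinity (for `p ≥ 2`, `d ≥ 1`). [folklore] -/
theorem tendsto_lvl {d : ℕ} (hp : 2 ≤ p) (hd : 1 ≤ d) : Filter.Tendsto (lvl p d) Filter.atTop Filter.atTop := by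
  have h2d : 2 * d ≠ 0 := by omega
  have hp1 : 0 < p - 1 := by omega
  refine Filter.tendsto_atTop_atTop.2 fun M => ⟨64 * ((p - 1) * M) ^ (2 * d) + 1, fun n hn => ?_⟩
  have h1 : ((p - 1) * M) ^ (2 * d) ≤ (n - 1) / 64 := by
    rw [Nat.le_div_iff_mul_le (by norm_num)]
    omega
  have h2 : (p - 1) * M ≤ Nat.nthRoot (2 * d) ((n - 1) / 64) := (Nat.le_nthRoot_iff h2d).2 h1
  unfold lvl
  rw [Nat.le_div_iff_mul_le hp1, mul_comm]
  exact h2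

omit [Fact p.Prime] in
/-- For `1 ≤ n`, `q(n) ≤ q(1) · n ^ deg q` for a polynomial over `ℕ`. [folklore] -/
theorem natPoly_eval_le (q : Polynomial ℕ) (hn : 1 ≤ n) : q.eval n ≤ q.eval 1 * n ^ q.natDegree := by
  rw [Polynomial.eval_eq_sum_range, Polynomial.eval_eq_sum_range, Finset.sum_mul]
  refine Finset.sum_le_sum fun i hi => ?_
  rw [one_pow, mul_one]
  exact Nat.mul_le_mul_left _ (Nat.pow_le_pow_right hn (Nat.lt_succ_iff.mp (Finset.mem_range.mp hi)))

/-- **`rsProperty p` is useful against `AC⁰[p]`** in the sense of `NaturalProofs.lean`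
(Razborov–Rudich: the Razborov–Smolensky lower bounds are natural; CIKK Thm. 5.3): a language
whose `n`-th slice has the property for infinitely many `n` is decided by no constant-depth
polynomial-size circuit family over `{¬, ∧, ∨, MOD_p}`. (At the infinitely many good lengths take
`ℓ = ℓ(n)`: the degree constraint holds by `lvl_spec`, and `16 · poly(n) < p^{ℓ(n)}` eventually since
`n` is polynomial in `ℓ(n)` by `le_of_lvl`.) [cite: CarmosinoImpagliazzoKabanetsKolokolova2016, Thm. 5.3] -/
theorem isUsefulAgainst_AC0Mod_rsProperty : IsUsefulAgainst (AC0Mod p) (rsProperty p) := by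
  intro L hfreq hL
  obtain ⟨d₀, q, C, hCn, hdec⟩ := hL
  have hp := (Fact.out : p.Prime)
  have hp2 : 2 ≤ p := hp.two_le
  set d := max d₀ 1 with hdmax
  have hd : 1 ≤ d := le_max_right _ _
  set k := q.natDegree with hk
  set c₁ := 64 * (p - 1) ^ (2 * d) + 64 with hc₁
  set A := 16 * q.eval 1 * c₁ ^ k with hA
  have hev2 := (tendsto_lvl hp2 hd).eventually (eventually_mul_pow_lt_two_pow A (2 * d * k))
  have hev3 := (tendsto_lvl hp2 hd).eventually (Filter.eventually_ge_atTop 1)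
  have hall : ∀ᶠ n in Filter.atTop, L.sliceFn n ∉ rsProperty p n := by
    filter_upwards [hev2, hev3, Filter.eventually_ge_atTop 1] with n h2 h3 hn1
    obtain ⟨hO, hD, hS⟩ := hCn n
    have hcomp : (C n).Computes (L.sliceFn n) := by
      intro x
      have key : ∀ (z : List Bool) (N : ℕ) (hz : z.length = N),
          (C N).eval (fun i => z.get (i.cast hz.symm)) = L.boolIndicator z := by
        rintro z _ rfl
        exact hdec z
      show (C n).eval x = L.boolIndicator (List.ofFn x)
      have := key (List.ofFn x) n (List.length_ofFn ..)
      simpa using this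
    refine not_mem_rsProperty_of_computes' hn1 (C n) hO (hD.trans (le_max_left _ _)) hcomp h3
      ((lvl_spec hd p n).trans ?_) ?_
    · unfold oddFloor; split_ifs <;> omega
    · have hnle : n ≤ c₁ * (lvl p d n + 1) ^ (2 * d) :=
        calc n ≤ 64 * ((p - 1) * (lvl p d n + 1)) ^ (2 * d) + 64 := le_of_lvl hp2 hd n
          _ = 64 * (p - 1) ^ (2 * d) * (lvl p d n + 1) ^ (2 * d) + 64 := by rw [mul_pow]; ring
          _ ≤ 64 * (p - 1) ^ (2 * d) * (lvl p d n + 1) ^ (2 * d) + 64 * (lvl p d n + 1) ^ (2 * d) :=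
              Nat.add_le_add_left (Nat.le_mul_of_pos_right _ (by positivity)) _
          _ = c₁ * (lvl p d n + 1) ^ (2 * d) := by rw [hc₁]; ring
      calc 16 * (C n).size ≤ 16 * q.eval n := Nat.mul_le_mul_left _ hS
        _ ≤ 16 * (q.eval 1 * n ^ k) := Nat.mul_le_mul_left _ (natPoly_eval_le q hn1)
        _ ≤ 16 * (q.eval 1 * (c₁ * (lvl p d n + 1) ^ (2 * d)) ^ k) := by gcongr
        _ = A * (lvl p d n + 1) ^ (2 * d * k) := by rw [hA, mul_pow, ← pow_mul]; ring
        _ < 2 ^ lvl p d n := h2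
        _ ≤ p ^ lvl p d n := Nat.pow_le_pow_left hp2 _
  exact hfreq hall

end Smolensky

end Literature.Computability.MetaComplexity
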